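import Summits.BirchSwinnertonDyer.BirchSwinnertonDyer.Theorems.QuadraticBranchSignedControlPlusEtaR0Rows01
import Summits.BirchSwinnertonDyer.BirchSwinnertonDyer.Theorems.QuadraticBranchSignedControlPlusEtaR0KuriharaRecords06
import HarnessLib

/-!
# Route `QuadraticBranchSignedControl` (rung K8, cell `bsd-potss`), crux `PlusEtaLowerInclusion`
# (stmt-BirchSwinnertonDyer-19601): THE RANK-0 TOWER-ONTO ROWS, COMPOSED — part 05, the LAST residue row
# (continuation of `…PlusEtaR0Rows01–04.lean`: same §1 generic composition, one further per-row corollary;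
# seat `bsd-potss-k8eta-c1`, gen 5; `--supports` crux 19601)

Row in this file: `288600bn1`@5 — the one rank-0 tower-onto census row that gen 2 left open (Tamagawa
defect `t = ord₅ ∏ c_ℓ = 1`, `ord₅ #Ш_an = 2`: its certificate is a level-`2` Kurihara number, out of the
series engines' reach; reached by the exact engine E, kit j275242, record
`PlusEtaR0Kurihara.etaR0_kur_v288600bn1_5` in `…PlusEtaR0KuriharaRecords06.lean`, p522427). With it the
rank-0 half of 19601 carries a composed kernel record on **19/19** census rows (gen 2: 18/19).

Per certified rank-`0` tower-onto row `W` (census kit j255146): the named facts (`hPT`, `hmod`, GZK,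
Kobayashi 2.2_η / 4.1_η, Kitajima–Otsuki 1.3_η, Kim 2026 Thm. 1.8 (6), Cremona's Manin computation) + the
DISPLAYED row data ⟹ for EVERY globally minimal `V` with `C • W^{(p*)} = V`, good at `p`, `a_p(V) = 0`,
`ρ_{V,p^m}` onto for all `m`: (E⁺_η)(V,p) ∧ (C1⁺_η)(V,p), via
`PlusEtaR0Rows.etaPair_of_rankZero_of_missingLowerBoundAt` (part 01, ctrl g4's converse road p463421).
HONEST LABEL: a CONDITIONAL per-row instance of the registered stubs' slots (`stub_etaLower_r0_lowerBSD` /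
`stub_etaLower_r0_ofLowerBSD`); the class-wide stubs stay OPEN; crux 19601 is NOT closed; nothing is
booked; `BSD(W,5)` is not claimed; no `sorry`, no new definition, axioms standard. The full framing, the
row table and the residue are in part 01's module docstring.

References: [Kobayashi2003] §4 + Thm. 4.1 (p. 8), Thm. 2.2 (p. 5); [KitajimaOtsuki2018] Thm. 1.3;
[Kim2022StructureSelmer] Thm. 1.9 (6); [Miller2011LMS] Def. 1.1; [Cremona1997] Table 1.
-/

set_option autoImplicit false
-- sibling precedent (`…PlusEtaR0Rows04.lean`): the directory name repeats the summit name
set_option linter.dupNamespace false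

noncomputable section

open scoped Classical

open CongruenceSubgroup WeierstrassCurve Literature.NumberTheory.EllipticCurves
open Literature.NumberTheory.EllipticCurves.ModularForms
open Literature.NumberTheory.EllipticCurves.Rank1Residual
open Literature.NumberTheory.EllipticCurves.Rank1Residual.Typed
open Literature.NumberTheory.EllipticCurves.Rank1Residual.X11RankOneCertificates
open Literature.NumberTheory.GaloisRepresentations
open Literature.NumberTheory.GaloisCohomology
open Summit.BirchSwinnertonDyer.Rank1Residual
open Summit.BirchSwinnertonDyer.Rank1Residual.Additive
open Summit.BirchSwinnertonDyer.Rank1Residual.X4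
open Summit.BirchSwinnertonDyer.Rank1Residual.X11b
open Summit.BirchSwinnertonDyer.Rank1Residual.Supersingular
open Summit.BirchSwinnertonDyer.BirchSwinnertonDyer.Rank1Residual.IntModel
open Summit.BirchSwinnertonDyer.BirchSwinnertonDyer.Rank1Residual.X11RankOne

namespace Summit.BirchSwinnertonDyer.BirchSwinnertonDyer.Theorems.PlusEtaR0Rows

/-! ## §2 (continued) The certified rows — the level-`2` row -/

/-- **(E⁺_η) ∧ (C1⁺_η) at `p = 5` for EVERY tower-onto good twist of `W = 288600bn1`** (Cremona's minimal model
`[0, -1, 0, -4235816083, -106109503819088]`, `N = 288600 = 5²·11544`, additive `e = 2` at `5` (I₀*); minimal `5*`-twist `V` of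
conductor `11544`: good supersingular, `a_5(V) = 0`, `ρ_{V,5^∞}` onto — census kit j255146; `r_an(W) = 0`, `#Ш(W)_an = 25`,
`∏ c_ℓ(W) = 80` (`ord₅ = 1`, `c₁₃ = 10`), `#W(ℚ)_tors = 2`): the named facts + Kim 2026 Thm. 1.8 (6) + the DISPLAYED row data
(`r_an(W) = 0`; the optimal datum; Cremona's Manin computation `h300` (`N ≤ 300000`); the cyclicity of the `5`-torsion of
`W̃(𝔽_{7451}) ≅ ℤ/7550`, `W̃(𝔽_{7951}) ≅ ℤ/3950 × ℤ/2` (`hcyc`); the LEVEL-`2` Kurihara number `δ̃_{59242901} ≡ 5 (mod 25)`, `≢ 0`, at the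
cyclic pair level `n = 7451·7951 ∈ 𝒩₂(W,5)`, kit j275242, engine E exact, Hecke `15400`/0) give L₀(W,5) by the record
`PlusEtaR0Kurihara.etaR0_kur_v288600bn1_5` (minimality, `Δ ≠ 0`, surjectivity of `ρ̄_{W,5}`, the point counts, the Tamagawa defect
`1 ≤ ord₅ ∏ c_ℓ` by a Tate row certificate, and the level IN THE KERNEL there), whence the pair's (E⁺_η) and (C1⁺_η) by §1.
CONDITIONAL; a per-row instance; nothing booked; `BSD(W,5)` not claimed.
[cite: Kobayashi2003, §4 Even main conjecture and Thm. 4.1 (p. 8)] [cite: Kim2022StructureSelmer, Thm. 1.9 (6) (PDF p. 8)]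
[cite: Cremona1997, Table 1 (label 288600bn1)] -/
theorem etaPair_r0_v288600bn1_5
    (hPT : poitouTate_selmerStructure_duality_real ℚ) (hmod : hasEntireLFunction_rat)
    (hGZK : rank_eq_analyticRank_of_analyticRank_le_one)
    (h22 : Kobayashi2003.thm22_etaSignedSelmerDual_finite_torsion)
    (h41 : Kobayashi2003.thm41_plusEtaCharIdeal_dvd)
    (hKO : KitajimaOtsuki2018.mainThm13_etaSignedSelmerDual_noFiniteSubmodule)
    (hKim : Kim2026.rankZero_le_padicValNat_sha_of_kuriharaNumber_ne_zero)
    (h300 : cremona_abs_maninConstant_eq_one_of_level_le_300000)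
    (W : WeierstrassCurve ℚ) (hW : W = ⟨0, -1, 0, -4235816083, -106109503819088⟩)
    (hr : W.analyticRank = 0) (D : ModularParametrizationData W 288600)
    (hopt : ∀ z ∈ D.L.lattice, ∃ w ∈ periodLattice D.f, z = D.c * w)
    (hcyc : ∀ (ℓ : ℕ) [Fact ℓ.Prime], ℓ ∣ 7451 * 7951 →
      Nat.card {P : ((⟨0, -1, 0, -4235816083, -106109503819088⟩ : WeierstrassCurve ℤ).map
          (Int.castRingHom (ZMod ℓ))).toAffine.Point // 5 • P = 0} ≤ 5)
    (hδ : ∃ ψ : (ℓ : ℕ) → (ZMod ℓ)ˣ →* Multiplicative (ZMod (5 ^ 2)),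
      (∀ ℓ ∈ (7451 * 7951 : ℕ).primeFactors, Function.Surjective (ψ ℓ)) ∧
        kuriharaNumber D.f (5 ^ 2) (7451 * 7951) ψ ≠ 0) :
    ∀ (V : WeierstrassCurve ℚ) [V.IsElliptic] [V.IsGloballyMinimal] [Fact (5 : ℕ).Prime],
      (∃ C : VariableChange ℚ, C • W.quadraticTwist 5 = V) →
      V.HasGoodReductionAtPrime 5 → V.frobeniusTrace 5 = 0 →
      (∀ m : ℕ, V.HasSurjectiveModNGaloisRep (5 ^ m : ℕ)) →
        QuadraticBranchPlusEtaLowerInclusionAt V 5 ∧ QuadraticBranchPlusEtaMainConjectureAt V 5 := by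
  have hlow : MissingLowerBoundAt W 5 :=
    PlusEtaR0Kurihara.etaR0_kur_v288600bn1_5 hKim hGZK hmod h300 W hW hr D hopt hcyc hδ
  subst hW
  haveI := PlusEtaR0Kurihara.isElliptic_v288600bn1
  haveI := PlusEtaR0Kurihara.isGloballyMinimal_v288600bn1
  intro V _ _ _ hC hgood hap hsurj
  obtain ⟨C, hCV⟩ := hC
  have hD : ((-1 : ℚ) ^ ((5 : ℕ) / 2) * ((5 : ℕ) : ℚ)) = 5 := by norm_num
  exact etaPair_of_rankZero_of_missingLowerBoundAt hPT hmod hGZK h22 h41 hKO _ 5 (by norm_num) hr hlow V C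
    (by rw [hD]; exact hCV) hgood hap hsurj

end Summit.BirchSwinnertonDyer.BirchSwinnertonDyer.Theorems.PlusEtaR0Rows

end
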